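import Mathlib
import HarnessLib.Audit
import Summits.PneNP.PneNP.Theorems.PstarMenuLocality

/-!
# When is a literal constant on the slice?  Necessary conditions for admissible decorations (ROUND-24, O1; memo g26 §64)

FRONTIER range-avoidance ladder, rung F-N3, ROUND 24 (cell `pnp-ideate`, prover-2 memo `g26/O1-LOCALITY-g26.md` §64; typed targets
`PstarCoreBoundTargets.TerminalFive` / `TerminalPeelable` (p646951); restricted-model proof complexity — nothing here bears on `P` versus `NP`).

By `PstarMenuLocality.starSum_pinned` / `PstarMenuRelease.terminal_release` a decoration `(s, π)` (`π` far) of an exact certificate `(K₀; d₁, d₂)` is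
admissible iff the literal `x_s` is CONSTANT on the slice `A = Sol(K₀) ∩ {d₁ = b₁}` (the planner's "A-constant column", p3 memo §14.69).  This file
gives the flip-based NECESSARY conditions, for any family `K` and first reader `Γ₁`:

* `solves_flip_of_partners_false`, `gval_flip_of_partners_false` — if at a point every PARTNER of `s` (the other AND variable of each output of `K` /
  monomial of `Γ₁` through `s`) is `0` and `s ∉ C₁`, then flipping `x_s` keeps `Sol(K)` and `Γ₁`;
* **`exists_partner_true_of_constant`** — hence if `x_s ≡ e` on `A`, every point of `A` has SOME partner of `s` equal to `1`;
* **`literal_true_of_private_constant`** — a PRIVATE AND variable `p` of a member `t ∈ K` (occurring nowhere else on the `Γ₁`-side) is constant on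
  `A` only if its literal `s_t ≡ 1` on `A` ("a release on a private needs the member's literal pinned to 1");
* **`partners_of_shared_constant`** — a literal `s` shared by exactly one member `t ∈ K` (partner `p`) and one fold `o ∈ G₁` (partner `q`), `s ∉ C₁`,
  is constant on `A` only if `(x_p, x_q) ≠ (0, 0)` throughout `A` (the "value-1 one-block arc" of the block rule).
-/

set_option linter.dupNamespace false -- `Summit.PneNP.PneNP.…`: summit = sub-problem name (D-0017 single-conjunct layout)

open Finset Literature.Computability.Complexity
open Summit.PneNP.PneNP.Theorems.PstarFibrePolys (bit bit_injective)
open Summit.PneNP.PneNP.Theorems.PstarSALevel (varSet)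
open Summit.PneNP.PneNP.Theorems.PstarCentreFree (vars_mem_varSet)
open Summit.PneNP.PneNP.Theorems.PstarGapPeeling (eval_pure eval_update_of_not_mem)
open Summit.PneNP.PneNP.Theorems.PstarGapOneAll (gval)
open Summit.PneNP.PneNP.Theorems.PstarMenuLocality (starSum bit_gval_flip)

namespace Summit.PneNP.PneNP.Theorems.PstarSliceConstancy

variable {n m : ℕ} {I : LocalMap 4 n m} {y : Fin m → Bool} {K : Finset (Fin m)} {w₁ : Finset (Fin n) × Finset (Fin m) × Bool} {s : Fin n}

/-- **Partners off ⇒ flipping `s` keeps the family.**  If `s` is no XOR variable of `K` and, at `x`, every output of `K` with `s` in an AND slot has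
its other AND variable `0`, then `x` with `x_s` flipped solves the same outputs of `K`. -/
theorem solves_flip_of_partners_false (hI : I.IsPure xorAndPred) (hsX : ∀ j ∈ K, I.vars j 0 ≠ s ∧ I.vars j 1 ≠ s) {x : Fin n → Bool}
    (hpart : ∀ j ∈ K, (I.vars j 2 = s → x (I.vars j 3) = false) ∧ (I.vars j 3 = s → x (I.vars j 2) = false))
    (hx : ∀ j ∈ K, I.eval x j = y j) (b : Bool) : ∀ j ∈ K, I.eval (Function.update x s b) j = y j := by
  intro j hj
  have hpq : I.vars j 2 ≠ I.vars j 3 := fun e => absurd (hI.2 j e) (by decide)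
  rw [← hx j hj, eval_pure I hI, eval_pure I hI, Function.update_of_ne (hsX j hj).1, Function.update_of_ne (hsX j hj).2]
  by_cases h2 : I.vars j 2 = s
  · have h3 : I.vars j 3 ≠ s := fun h => hpq (h2.trans h.symm)
    rw [Function.update_of_ne h3, (hpart j hj).1 h2, Bool.and_false, Bool.and_false]
  · by_cases h3 : I.vars j 3 = s
    · rw [Function.update_of_ne h2, (hpart j hj).2 h3, Bool.false_and, Bool.false_and]
    · rw [Function.update_of_ne h2, Function.update_of_ne h3]

/-- **Partners off ⇒ flipping `s` keeps the reader.**  If `s ∉ C` and, at `x`, every monomial of `G` through `s` has its partner `0`, then flipping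
`x_s` does not move `gval C G`. -/
theorem gval_flip_of_partners_false (hI : I.IsPure xorAndPred) {C : Finset (Fin n)} {G : Finset (Fin m)} (hsC : s ∉ C) {x : Fin n → Bool}
    (hpart : ∀ g ∈ G, (I.vars g 2 = s → x (I.vars g 3) = false) ∧ (I.vars g 3 = s → x (I.vars g 2) = false)) :
    gval I C G (Function.update x s (!x s)) = gval I C G x := by
  apply bit_injective
  have h0 : starSum I G s x = 0 := by
    unfold PstarMenuLocality.starSum
    refine sum_eq_zero fun g hg => ?_
    by_cases h2 : I.vars g 2 = s
    · have h3 : I.vars g 3 ≠ s := fun h => absurd (h2.trans h.symm) fun e => absurd (hI.2 g e) (by decide)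
      rw [if_pos h2, if_neg h3, (hpart g hg).1 h2]; simp [bit]
    · by_cases h3 : I.vars g 3 = s
      · rw [if_neg h2, if_pos h3, (hpart g hg).2 h3]; simp [bit]
      · rw [if_neg h2, if_neg h3, add_zero]
  rw [bit_gval_flip I hI, if_neg hsC, h0, add_zero, add_zero]

/-- **A-CONSTANT ⇒ SOME PARTNER IS ON, everywhere on the slice.**  If `x_s ≡ e` on `A = Sol(K) ∩ {Γ₁ = b₁}` (with `s` no XOR variable of `K`, `s ∉ C₁`),
then at every point of `A` some output of `K` or monomial of `Γ₁` through `s` has its partner equal to `1`. -/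
theorem exists_partner_true_of_constant (hI : I.IsPure xorAndPred) (hsX : ∀ j ∈ K, I.vars j 0 ≠ s ∧ I.vars j 1 ≠ s) (hsC : s ∉ w₁.1) {e : Bool}
    (hconst : ∀ z : Fin n → Bool, (∀ j ∈ K, I.eval z j = y j) → gval I w₁.1 w₁.2.1 z = w₁.2.2 → z s = e)
    {x : Fin n → Bool} (hx : ∀ j ∈ K, I.eval x j = y j) (hx₁ : gval I w₁.1 w₁.2.1 x = w₁.2.2) :
    (∃ j ∈ K, (I.vars j 2 = s ∧ x (I.vars j 3) = true) ∨ (I.vars j 3 = s ∧ x (I.vars j 2) = true)) ∨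
      ∃ g ∈ w₁.2.1, (I.vars g 2 = s ∧ x (I.vars g 3) = true) ∨ (I.vars g 3 = s ∧ x (I.vars g 2) = true) := by
  by_contra h
  push Not at h
  obtain ⟨hK, hG⟩ := h
  have hpartK : ∀ j ∈ K, (I.vars j 2 = s → x (I.vars j 3) = false) ∧ (I.vars j 3 = s → x (I.vars j 2) = false) := fun j hj =>
    ⟨fun h2 => by simpa using (hK j hj).1 h2, fun h3 => by simpa using (hK j hj).2 h3⟩
  have hpartG : ∀ g ∈ w₁.2.1, (I.vars g 2 = s → x (I.vars g 3) = false) ∧ (I.vars g 3 = s → x (I.vars g 2) = false) := fun g hg =>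
    ⟨fun h2 => by simpa using (hG g hg).1 h2, fun h3 => by simpa using (hG g hg).2 h3⟩
  have hx' := solves_flip_of_partners_false hI hsX hpartK hx (!x s)
  have hx'₁ : gval I w₁.1 w₁.2.1 (Function.update x s (!x s)) = w₁.2.2 := by rw [gval_flip_of_partners_false hI hsC hpartG]; exact hx₁
  have e1 := hconst x hx hx₁
  have e2 := hconst _ hx' hx'₁
  rw [Function.update_self, e1] at e2
  revert e2; cases e <;> decide

/-- **A RELEASE ON A PRIVATE NEEDS THE LITERAL PINNED TO ONE.**  `t ∈ K` with AND slots `(s_t, p)` (either order); `p` occurs in no other output of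
`K`, in no monomial of `Γ₁`, not in `C₁`, and is no XOR variable of `K`.  If `x_p ≡ e` on the slice then `x_{s_t} ≡ 1` on the slice. -/
theorem literal_true_of_private_constant (hI : I.IsPure xorAndPred) {t : Fin m} (ht : t ∈ K) {sₜ p : Fin n}
    (hslots : (I.vars t 2 = sₜ ∧ I.vars t 3 = p) ∨ (I.vars t 2 = p ∧ I.vars t 3 = sₜ)) (hpX : ∀ j ∈ K, I.vars j 0 ≠ p ∧ I.vars j 1 ≠ p)
    (hpK : ∀ j ∈ K, j ≠ t → I.vars j 2 ≠ p ∧ I.vars j 3 ≠ p) (hpC : p ∉ w₁.1) (hpG : ∀ g ∈ w₁.2.1, I.vars g 2 ≠ p ∧ I.vars g 3 ≠ p) {e : Bool}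
    (hconst : ∀ z : Fin n → Bool, (∀ j ∈ K, I.eval z j = y j) → gval I w₁.1 w₁.2.1 z = w₁.2.2 → z p = e)
    {x : Fin n → Bool} (hx : ∀ j ∈ K, I.eval x j = y j) (hx₁ : gval I w₁.1 w₁.2.1 x = w₁.2.2) : x sₜ = true := by
  have hsp : sₜ ≠ p := by
    have h23 : I.vars t 2 ≠ I.vars t 3 := fun e => absurd (hI.2 t e) (by decide)
    rcases hslots with ⟨h2, h3⟩ | ⟨h2, h3⟩
    · rw [← h2, ← h3]; exact h23
    · rw [← h2, ← h3]; exact h23.symm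
  rcases exists_partner_true_of_constant hI hpX hpC hconst hx hx₁ with ⟨j, hj, h⟩ | ⟨g, hg, h⟩
  · by_cases hjt : j = t
    · subst hjt
      rcases hslots with ⟨h2, h3⟩ | ⟨h2, h3⟩
      · rcases h with ⟨h2', _⟩ | ⟨_, hv⟩
        · exact absurd (h2.symm.trans h2') hsp
        · rw [h2] at hv; exact hv
      · rcases h with ⟨_, hv⟩ | ⟨h3', _⟩
        · rw [h3] at hv; exact hv
        · exact absurd (h3.symm.trans h3') hsp
    · rcases h with ⟨h2, -⟩ | ⟨h3, -⟩
      · exact absurd h2 (hpK j hj hjt).1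
      · exact absurd h3 (hpK j hj hjt).2
  · rcases h with ⟨h2, -⟩ | ⟨h3, -⟩
    · exact absurd h2 (hpG g hg).1
    · exact absurd h3 (hpG g hg).2

/-- **A SHARED LITERAL IS PINNED ONLY BY A VALUE-ONE ARC.**  `s` is the AND variable shared by exactly one member `t ∈ K` (partner `p`) and exactly
one monomial `o` of `Γ₁` (partner `q`), `s ∉ C₁`, `s` no XOR variable of `K`.  If `x_s ≡ e` on the slice then `(x_p, x_q) ≠ (0, 0)` at every point of
the slice. -/
theorem partners_of_shared_constant (hI : I.IsPure xorAndPred) (hsX : ∀ j ∈ K, I.vars j 0 ≠ s ∧ I.vars j 1 ≠ s) (hsC : s ∉ w₁.1)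
    {t o : Fin m} {p q : Fin n} (htK : ∀ j ∈ K, (I.vars j 2 = s ∨ I.vars j 3 = s) → j = t)
    (htslots : (I.vars t 2 = s ∧ I.vars t 3 = p) ∨ (I.vars t 2 = p ∧ I.vars t 3 = s))
    (hoG : ∀ g ∈ w₁.2.1, (I.vars g 2 = s ∨ I.vars g 3 = s) → g = o)
    (hoslots : (I.vars o 2 = s ∧ I.vars o 3 = q) ∨ (I.vars o 2 = q ∧ I.vars o 3 = s)) {e : Bool}
    (hconst : ∀ z : Fin n → Bool, (∀ j ∈ K, I.eval z j = y j) → gval I w₁.1 w₁.2.1 z = w₁.2.2 → z s = e)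
    {x : Fin n → Bool} (hx : ∀ j ∈ K, I.eval x j = y j) (hx₁ : gval I w₁.1 w₁.2.1 x = w₁.2.2) : x p = true ∨ x q = true := by
  have hts : I.vars t 2 ≠ I.vars t 3 := fun e => absurd (hI.2 t e) (by decide)
  have hos : I.vars o 2 ≠ I.vars o 3 := fun e => absurd (hI.2 o e) (by decide)
  rcases exists_partner_true_of_constant hI hsX hsC hconst hx hx₁ with ⟨j, hj, h⟩ | ⟨g, hg, h⟩
  · have hjt : j = t := htK j hj (h.elim (fun h => Or.inl h.1) fun h => Or.inr h.1)
    subst hjt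
    left
    rcases htslots with ⟨h2, h3⟩ | ⟨h2, h3⟩
    · rcases h with ⟨_, hv⟩ | ⟨h3', _⟩
      · rw [h3] at hv; exact hv
      · exact absurd (h2.trans h3'.symm) hts
    · rcases h with ⟨h2', _⟩ | ⟨_, hv⟩
      · exact absurd (h2'.trans h3.symm) hts
      · rw [h2] at hv; exact hv
  · have hgo : g = o := hoG g hg (h.elim (fun h => Or.inl h.1) fun h => Or.inr h.1)
    subst hgo
    right
    rcases hoslots with ⟨h2, h3⟩ | ⟨h2, h3⟩
    · rcases h with ⟨_, hv⟩ | ⟨h3', _⟩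
      · rw [h3] at hv; exact hv
      · exact absurd (h2.trans h3'.symm) hos
    · rcases h with ⟨h2', _⟩ | ⟨_, hv⟩
      · exact absurd (h2'.trans h3.symm) hos
      · rw [h2] at hv; exact hv

end Summit.PneNP.PneNP.Theorems.PstarSliceConstancy
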